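import Mathlib
import HarnessLib

/-!
# Gesmundo–Ghosal–Ikenmeyer–Lysikov 2022, Proposition 9: slice rank decompositions and linear
# subspaces of the hypersurface

Topic `Literature/Computability/AlgebraicComplexity`; sibling of `GGIL22RestrictedStrength.lean` (Definitions
5/8/10, Proposition 11, Theorem 12 of the same source).  Source: F. Gesmundo, P. Ghosal, C. Ikenmeyer,
V. Lysikov, *Degree-restricted strength decompositions and algebraic branching programs*, FSTTCS 2022,
arXiv:2205.02149 [GesmundoGhosalIkenmeyerLysikov2022], held text `paper:arxiv-2205.02149` p0005 L44–L52,
verbatim: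

"Slice rank decompositions of a polynomial `F` have a clear geometric interpretation in terms of linear
subspaces contained in the hypersurface `Z(F)`.
▶ **Proposition 9.** Let `F` be a homogeneous polynomial. We have `sr(F) ≤ r` if and only if `Z(F)`
contains a linear subspace of codimension `r`.
Proof. The polynomial `F` admits a decomposition `F = Σ_{k=1}^r L_k H_k` for linear forms `L_1, …, L_k`
if and only if `F ∈ ⟨L_1, …, L_k⟩`. The ideal `⟨L_1, …, L_k⟩` is radical … Therefore, by the classic
Nullstellensatz, the condition `F ∈ ⟨L_1, …, L_k⟩` is equivalent to the condition
`Z(F) ⊃ Z(L_1, …, L_r)`. ◀"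

## What is proved (no definition, no named fact)

Over an INFINITE field `K` (the source works over `ℂ`; no algebraic closure is needed — the
Nullstellensatz for an ideal generated by linear forms is elementary), in finitely many variables `σ`:

* `GGIL22.exists_eq_sum_linear_mul_of_forall_eval_eq_zero` — **the "if" direction in ideal form**: if a
  polynomial `F` (not necessarily homogeneous) vanishes at every common zero of the linear forms
  `L_1, …, L_r`, then `F = Σ_i L_i H_i` for some polynomials `H_i`, i.e. `F ∈ ⟨L_1, …, L_r⟩`.  Proof by
  induction on `r`, eliminating one variable per form: if `L_0 ≠ 0` has a coefficient `c ≠ 0` at `x_{j₀}`,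
  the substitution `s : x_{j₀} ↦ x_{j₀} − c⁻¹ L_0` (identity on the other variables) satisfies
  `P − P∘s ∈ ⟨L_0⟩` for every `P` and `L_0∘s = 0`; `F∘s` vanishes at the common zeros of the `L_i∘s`
  (`i ≥ 1`) because `s` maps every point into `Z(L_0)`; induct, and reassemble.  The case `r = 0` is
  `MvPolynomial.funext` (a polynomial vanishing everywhere over an infinite field is `0`).
* `GGIL22.forall_eval_eq_zero_of_eq_sum_linear_mul` — the trivial "only if" direction.
* `GGIL22.exists_linear_iff_exists_submodule` — the GEOMETRIC reading: `F ∈ ⟨L_1, …, L_r⟩` for some `r`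
  linear forms iff `F` vanishes on a linear subspace `W ≤ K^σ` with `dim W + r ≥ #σ` ("`Z(F)` contains a
  linear subspace of codimension `r`"; a common zero set of `r` forms has codimension `≤ r`, and a subspace
  of codimension `c ≤ r` is the common zero set of `c ≤ r` coordinate functionals of the quotient).
With the sibling file's `GGIL22.sliceRank_le_of_eq_sum_linear_mul` / `hasRestrictedDecomp_of_eq_sum_mul`
(cofactors may be homogenised) these are exactly Proposition 9 for `sr(F) = GGIL22.sliceRank d F`,
`F` a form of degree `d ≥ 1`.

Honest framing: an elementary linear-algebra fact recorded for the rank-law vocabulary of the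
`ValiantsHypothesis` line `laplace_rigidity` (Chan–Ilten's `PR₁(per_n) = n` is the case `F = per_n` read
through this dictionary: tree `ChanIlten.finrank_le_of_permanent_eq_zero` /
`ChanIlten.le_of_perPoly_eq_sum_linear_mul`); nothing here bears on `VP ≠ VNP` (NOT proved), and no
summit statement is proved in this file.

[cite: GesmundoGhosalIkenmeyerLysikov2022, Proposition 9]
-/

noncomputable section

namespace Literature.Computability.AlgebraicComplexity.GGIL22

open MvPolynomial Finset

variable {σ : Type*} {K : Type*} [Field K]

/-! ### Linear forms and substitutions -/

/-- A linear form is the sum of its coefficients times the variables. [folklore] -/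
private theorem eq_sum_C_mul_X_of_isHomogeneous_one [Fintype σ] {p : MvPolynomial σ K}
    (hp : p.IsHomogeneous 1) : p = ∑ s, C (coeff (Finsupp.single s 1) p) * X s := by
  classical
  ext d
  simp only [coeff_sum, coeff_C_mul, coeff_X, mul_ite, mul_one, mul_zero]
  by_cases hd : Finsupp.degree d = 1
  · obtain ⟨z, rfl⟩ : d ∈ Set.range fun a : σ => Finsupp.single a 1 := by
      rw [Finsupp.range_single_one]
      exact hd
    rw [Finset.sum_eq_single z]
    · rw [if_pos rfl]
    · intro s _ hs
      exact if_neg fun h => hs (Finsupp.single_left_injective one_ne_zero h)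
    · exact fun h => absurd (Finset.mem_univ z) h
  · rw [hp.coeff_eq_zero hd]
    symm
    refine Finset.sum_eq_zero fun s _ => if_neg ?_
    rintro rfl
    exact hd (by rw [Finsupp.degree_single])

/-- Evaluating a linear form: `L(x) = Σ_j coeff_j(L) · x_j`. [folklore] -/
private theorem eval_eq_sum_coeff_mul [Fintype σ] {L : MvPolynomial σ K} (hL : L.IsHomogeneous 1)
    (x : σ → K) : eval x L = ∑ j, coeff (Finsupp.single j 1) L * x j := by
  conv_lhs => rw [eq_sum_C_mul_X_of_isHomogeneous_one hL]
  simp only [map_sum, map_mul, eval_C, eval_X]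

/-- `P − P∘s` lies in any ideal containing all `x_j − s_j` (substitution lemma). [folklore] -/
private theorem sub_aeval_mem_ideal {I : Ideal (MvPolynomial σ K)} (s : σ → MvPolynomial σ K)
    (hs : ∀ j, X j - s j ∈ I) (P : MvPolynomial σ K) : P - aeval s P ∈ I := by
  induction P using MvPolynomial.induction_on with
  | C a =>
    rw [aeval_C, algebraMap_eq, sub_self]
    exact I.zero_mem
  | add p q hp hq =>
    have : p + q - aeval s (p + q) = (p - aeval s p) + (q - aeval s q) := by
      rw [map_add]; ring
    rw [this]
    exact I.add_mem hp hq
  | mul_X p j hp =>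
    have : p * X j - aeval s (p * X j) = p * (X j - s j) + (p - aeval s p) * s j := by
      rw [map_mul, aeval_X]; ring
    rw [this]
    exact I.add_mem (I.mul_mem_left _ (hs j)) (I.mul_mem_right _ hp)

/-- Evaluation after substitution: `(P∘s)(x) = P(s(x))`. [folklore] -/
private theorem eval_aeval_eq (s : σ → MvPolynomial σ K) (x : σ → K) (P : MvPolynomial σ K) :
    eval x (aeval s P) = eval (fun j => eval x (s j)) P := by
  induction P using MvPolynomial.induction_on with
  | C a => simp only [aeval_C, algebraMap_eq, eval_C]
  | add p q hp hq => simp only [map_add, hp, hq]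
  | mul_X p j hp => simp only [map_mul, aeval_X, eval_X, hp]

/-! ### Proposition 9, "if": vanishing on the common zeros of linear forms forces ideal membership -/

/-- **GGIL22 Proposition 9, the "if" direction, ideal form** (elementary Nullstellensatz for ideals of
linear forms over an infinite field): if `F` vanishes at every common zero of the linear forms
`L_0, …, L_{r−1}`, then `F = Σ_i L_i · H_i` for some polynomials `H_i`.
[cite: GesmundoGhosalIkenmeyerLysikov2022, Proposition 9] -/
theorem exists_eq_sum_linear_mul_of_forall_eval_eq_zero [Fintype σ] [DecidableEq σ] [Infinite K] :
    ∀ (r : ℕ) (L : Fin r → MvPolynomial σ K), (∀ i, (L i).IsHomogeneous 1) →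
      ∀ F : MvPolynomial σ K, (∀ x : σ → K, (∀ i, eval x (L i) = 0) → eval x F = 0) →
        ∃ H : Fin r → MvPolynomial σ K, F = ∑ i, L i * H i := by
  intro r
  induction r with
  | zero =>
    intro L _ F hF
    refine ⟨Fin.elim0, ?_⟩
    rw [Finset.univ_eq_empty, Finset.sum_empty]
    exact MvPolynomial.funext fun x => by rw [hF x fun i => i.elim0, map_zero]
  | succ r ih =>
    intro L hL F hF
    by_cases h0 : L 0 = 0
    · -- the first form is `0`: drop it
      obtain ⟨H', hH'⟩ := ih (fun i => L i.succ) (fun i => hL i.succ) F fun x hx =>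
        hF x (Fin.cases (by rw [h0, map_zero]) hx)
      refine ⟨Fin.cons 0 H', ?_⟩
      rw [Fin.sum_univ_succ, Fin.cons_zero, mul_zero, zero_add]
      simpa only [Fin.cons_succ] using hH'
    · -- a variable `j₀` with nonzero coefficient `c` in `L 0`
      set c : σ → K := fun j => coeff (Finsupp.single j 1) (L 0) with hc
      have hexp : L 0 = ∑ j, C (c j) * X j := eq_sum_C_mul_X_of_isHomogeneous_one (hL 0)
      obtain ⟨j₀, hj₀⟩ : ∃ j₀, c j₀ ≠ 0 := by
        by_contra hall
        apply h0
        rw [hexp]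
        refine Finset.sum_eq_zero fun j _ => ?_
        have hj : c j = 0 := not_not.mp fun h => hall ⟨j, h⟩
        rw [hj, C_0, zero_mul]
      -- the substitution `x_{j₀} ↦ x_{j₀} − c⁻¹ L 0`
      let s : σ → MvPolynomial σ K := Function.update X j₀ (X j₀ - C (c j₀)⁻¹ * L 0)
      have hsj₀ : s j₀ = X j₀ - C (c j₀)⁻¹ * L 0 := Function.update_self _ _ _
      have hsj : ∀ j, j ≠ j₀ → s j = X j := fun j hj => Function.update_of_ne hj _ _
      -- (a) `x_j − s_j ∈ ⟨L 0⟩`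
      have hsI : ∀ j, X j - s j ∈ Ideal.span ({L 0} : Set (MvPolynomial σ K)) := by
        intro j
        by_cases hj : j = j₀
        · subst hj
          rw [hsj₀, sub_sub_cancel]
          exact Ideal.mul_mem_left _ _ (Ideal.subset_span rfl)
        · rw [hsj j hj, sub_self]
          exact Ideal.zero_mem _
      -- (b) `(L 0)∘s = 0`
      have hL0s : aeval s (L 0) = 0 := by
        have h1 : aeval s (L 0) = ∑ j, C (c j) * s j := by
          conv_lhs => rw [hexp]
          simp only [map_sum, map_mul, aeval_C, algebraMap_eq, aeval_X]
        have h2 : ∑ j, C (c j) * s j - ∑ j, C (c j) * X j = C (c j₀) * (s j₀ - X j₀) := by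
          rw [← Finset.sum_sub_distrib]
          rw [Finset.sum_eq_single j₀ (fun j _ hj => by rw [hsj j hj, sub_self]) (fun h =>
            absurd (Finset.mem_univ j₀) h)]
          ring
        have h3 : C (c j₀) * (s j₀ - X j₀) = -L 0 := by
          rw [hsj₀, show X j₀ - C (c j₀)⁻¹ * L 0 - X j₀ = -(C (c j₀)⁻¹ * L 0) by ring, mul_neg,
            ← mul_assoc, ← C_mul, mul_inv_cancel₀ hj₀, C_1, one_mul]
        calc aeval s (L 0)
            = (∑ j, C (c j) * s j - ∑ j, C (c j) * X j) + ∑ j, C (c j) * X j := by rw [h1]; ring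
          _ = -L 0 + L 0 := by rw [h2, h3, ← hexp]
          _ = 0 := neg_add_cancel (L 0)
      -- the substituted forms and the induction hypothesis
      have hs1 : ∀ j, (s j).IsHomogeneous 1 := by
        intro j
        by_cases hj : j = j₀
        · subst hj
          rw [hsj₀]
          exact (isHomogeneous_X K _).sub ((hL 0).C_mul _)
        · rw [hsj j hj]
          exact isHomogeneous_X K j
      have hL's : ∀ i : Fin r, (aeval s (L i.succ)).IsHomogeneous 1 := fun i => by
        simpa using (hL i.succ).aeval s hs1
      obtain ⟨H', hH'⟩ := ih (fun i => aeval s (L i.succ)) hL's (aeval s F) fun x hx => by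
        rw [eval_aeval_eq]
        refine hF _ (Fin.cases ?_ fun i => ?_)
        · rw [← eval_aeval_eq, hL0s, map_zero]
        · rw [← eval_aeval_eq]
          exact hx i
      -- (d) reassemble modulo `⟨L 0⟩`
      obtain ⟨Q, hQ⟩ := Ideal.mem_span_singleton'.mp (sub_aeval_mem_ideal s hsI F)
      have hci : ∀ i : Fin r, ∃ ci, ci * L 0 = L i.succ - aeval s (L i.succ) := fun i =>
        Ideal.mem_span_singleton'.mp (sub_aeval_mem_ideal s hsI (L i.succ))
      choose ci hci using hci
      refine ⟨Fin.cons (Q - ∑ i, ci i * H' i) H', ?_⟩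
      have hF' : F = Q * L 0 + aeval s F := by rw [hQ]; ring
      have hLi : ∀ i : Fin r, aeval s (L i.succ) = L i.succ - ci i * L 0 := fun i => by
        rw [hci i]; ring
      rw [Fin.sum_univ_succ, Fin.cons_zero]
      simp only [Fin.cons_succ]
      rw [hF', hH', Finset.sum_congr rfl fun i _ => by rw [hLi i]]
      simp only [sub_mul, Finset.sum_sub_distrib, mul_sub, Finset.mul_sum]
      have : ∑ i, L 0 * (ci i * H' i) = ∑ i, ci i * L 0 * H' i :=
        Finset.sum_congr rfl fun i _ => by ring
      rw [this]
      ring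

/-- **GGIL22 Proposition 9, the "only if" direction:** if `F = Σ_i L_i H_i` with linear forms `L_i`, then
`F` vanishes at every common zero of the `L_i`. [cite: GesmundoGhosalIkenmeyerLysikov2022, Proposition 9] -/
theorem forall_eval_eq_zero_of_eq_sum_linear_mul {r : ℕ} (L H : Fin r → MvPolynomial σ K)
    {F : MvPolynomial σ K} (h : F = ∑ i, L i * H i) (x : σ → K) (hx : ∀ i, eval x (L i) = 0) :
    eval x F = 0 := by
  rw [h, map_sum]
  exact Finset.sum_eq_zero fun i _ => by rw [map_mul, hx i, zero_mul]

/-! ### Proposition 9, geometric reading: subspaces of `Z(F)` of codimension `≤ r` -/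

/-- **GGIL22 Proposition 9 (geometric form).**  Over an infinite field, for a polynomial `F` in the
variables `σ` and `r : ℕ`, the following are equivalent: (i) `F = Σ_{i<r} L_i H_i` for some `r` LINEAR
forms `L_i` and polynomials `H_i` (i.e. `sr(F) ≤ r` once cofactors are homogenised, sibling file);
(ii) `F` vanishes identically on a linear subspace `W ≤ K^σ` with `dim W + r ≥ #σ` ("`Z(F)` contains a
linear subspace of codimension `r`").  (i)⇒(ii): the common kernel of the coefficient functionals
(rank–nullity); (ii)⇒(i): `W` is the common zero set of the `#σ − dim W ≤ r` coordinate functionals of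
`K^σ/W` (padded with zero forms), then `exists_eq_sum_linear_mul_of_forall_eval_eq_zero`.
[cite: GesmundoGhosalIkenmeyerLysikov2022, Proposition 9] -/
theorem exists_linear_iff_exists_submodule [Fintype σ] [DecidableEq σ] [Infinite K]
    (F : MvPolynomial σ K) (r : ℕ) :
    (∃ L H : Fin r → MvPolynomial σ K, (∀ i, (L i).IsHomogeneous 1) ∧ F = ∑ i, L i * H i) ↔
      ∃ W : Submodule K (σ → K), Fintype.card σ ≤ Module.finrank K W + r ∧
        ∀ x ∈ W, eval x F = 0 := by
  classical
  constructor
  · rintro ⟨L, H, hL, hF⟩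
    -- the common kernel of the coefficient functionals
    let Φ : (σ → K) →ₗ[K] (Fin r → K) :=
      { toFun := fun x i => ∑ j, coeff (Finsupp.single j 1) (L i) * x j
        map_add' := fun x y => by
          ext i
          simp [mul_add, Finset.sum_add_distrib]
        map_smul' := fun a x => by
          ext i
          simp [Finset.mul_sum, mul_left_comm] }
    refine ⟨LinearMap.ker Φ, ?_, fun x hx => ?_⟩
    · have hrn := LinearMap.finrank_range_add_finrank_ker Φ
      have hrange : Module.finrank K (LinearMap.range Φ) ≤ r :=
        (Submodule.finrank_le _).trans (by simp)
      have hV : Module.finrank K (σ → K) = Fintype.card σ := by simp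
      omega
    · refine forall_eval_eq_zero_of_eq_sum_linear_mul L H hF x fun i => ?_
      rw [eval_eq_sum_coeff_mul (hL i)]
      exact congr_fun (LinearMap.mem_ker.mp hx) i
  · rintro ⟨W, hW, hWF⟩
    -- coordinate functionals of the quotient `K^σ / W`
    set cq := Module.finrank K ((σ → K) ⧸ W) with hcq
    have hq : cq + Module.finrank K W = Fintype.card σ := by
      rw [hcq, Submodule.finrank_quotient_add_finrank]; simp
    have hcr : cq ≤ r := by omega
    let bQ := Module.finBasis K ((σ → K) ⧸ W)
    let φ : Fin cq → (σ → K) →ₗ[K] K := fun i => (bQ.coord i).comp W.mkQ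
    -- the corresponding linear forms, padded with zeros up to `r`
    let L : Fin r → MvPolynomial σ K := fun i =>
      if h : i.val < cq then ∑ j, C (φ ⟨i.val, h⟩ (Pi.single j 1)) * X j else 0
    have hLhom : ∀ i, (L i).IsHomogeneous 1 := by
      intro i
      simp only [L]
      split_ifs
      · exact IsHomogeneous.sum _ _ _ fun j _ => (isHomogeneous_X K j).C_mul _
      · exact isHomogeneous_zero _ _ _
    have hLeval : ∀ (i : Fin r) (h : i.val < cq) (x : σ → K), eval x (L i) = φ ⟨i.val, h⟩ x := by
      intro i h x
      simp only [L, dif_pos h, map_sum, map_mul, eval_C, eval_X]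
      have hx : x = ∑ j, x j • (Pi.single j (1 : K) : σ → K) := by
        ext k
        simp [Finset.sum_apply, Pi.single_apply]
      conv_rhs => rw [hx, map_sum]
      exact Finset.sum_congr rfl fun j _ => by rw [map_smul, smul_eq_mul, mul_comm]
    obtain ⟨H, hH⟩ := exists_eq_sum_linear_mul_of_forall_eval_eq_zero r L hLhom F fun x hx => by
      apply hWF
      -- all quotient coordinates of `x` vanish, so `x ∈ W`
      rw [← Submodule.Quotient.mk_eq_zero, ← bQ.forall_coord_eq_zero_iff]
      intro i
      have h := hx ⟨i.val, lt_of_lt_of_le i.isLt hcr⟩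
      rw [hLeval _ i.isLt] at h
      exact h
    exact ⟨L, H, hLhom, hH⟩

end Literature.Computability.AlgebraicComplexity.GGIL22

end
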